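import Literature.MathematicalPhysics.QuantumFieldTheory.Balaban1983to89.Node00.Record11CarriersB12
import Literature.MathematicalPhysics.QuantumFieldTheory.Balaban1983to89.B8Thm4TruncationLocal

/-!
# NODE 00 (YM-PLAN Track A) — STAGE 3′(X.B8′): THE [Balaban1985RegularSpaces] SUB-FAMILY PIN — the admitted family index `IdxB8` CUT DOWN to print's own members by the
# three located INDEX LAWS (n05-a g5∕g6: №7 the scale law `Lᵏη ≤ 1`, №8 the truncation law of the constraint towers, №11 the graded cover law (1.6) at every level), the
# [B8] group of record RE-KEYED over the sub-index (`withB8OfRecordSub`, same residual layer `ResidB8`), the surviving leaf over the sub-family (`B8LeafOfRecordSub`) and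
# OLD ⇒ NEW = g31's `b8LeafOfRecord_subtype` BY NAME; the sub-index is INHABITED by genuine members at every depth

NODE 00 CARRIER MODULE, seventh pin (seat `pub-ymgap-node00-def` g32, 2026-08-26; director-ym R134 (c) trigger t3 «`IdxB8′` sub-family re-key via `b8LeafOfRecord_subtype`»;
g31's `CarriersB8` v1.1 §2c «SUB-FAMILY READINESS»; n05-a's design points `HOME/pub-ymgap-dag-n05-a/B8-PIN-DESIGN-g5.md` §4 №7, §7 №8, HANDOFF g6 №11 with the kernel certificate
`B8Ineq165AllLevelsIndexLaw.exists_counterexample_allLevels_without_h16` (p445781) that №11 is NECESSARY for (1.65)).  APPEND-ONLY: a NEW importing module; `CarriersB8`, the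
record chain and n05-a's modules untouched and CONSUMED BY NAME.  [Balaban1985RegularSpaces] = T. Bałaban, *Spaces of regular gauge field configurations on a lattice and gauge
fixing conditions*, Commun. Math. Phys. **99** (1985) 75–102 (cell paper B8).

WHY A SUB-FAMILY.  g31 pinned the gauge-fixing family of record over `IdxB8 θ = {i : ZdIdx θ.D θ.L ∕∕ i.Ω 0 = univ}` — n05-a's geometric data with the box ∕ class ∕ tower ∕
partition laws of (1.3)–(1.6) at level `0`.  Three further relations that PRINT HAS BY CONSTRUCTION are NOT fields of `ZdIdx`: (№7) `η = L⁻ᵏ`, so `Lᵏη ≤ 1` (p. 77 «T_η,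
η = L^{−k}»; the providers' windows — [3] (167) `β·Lᵏη < ½`, the datum sizes of Thm 4 — are uniform in `j` only under it); (№8) the level-`m` constraint towers `Λs m` ARE the
truncations of the top tower `Λs k` ((1.19)∕(1.34): Prop. 7's axial map must produce ONE perturbation in `Ax` for all `m ≤ k` — `B8Thm4TruncationLocal.inAx_truncate`,
`B8Prop5SocketDatum.restr129_succ_of_truncation`); (№11) (1.6) «⋃_j ⋃_{y ∈ Λ_j} B^j(y) ⊇ Ω» AT EVERY LEVEL `ℓ ≤ k`, not only at `ℓ = 0` (`hpart`) — the hypothesis `h16` of n05-a's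
(1.65) bridge `B8Ineq165AllLevels.norm_avg_sub_le_allLevels_of135`, certified NECESSARY in the kernel.  Over the full index the `t2`∕`t4`∕`p7` conjuncts of the surviving leaf
range over members print never considers (on which (1.65) FAILS); over the sub-index `IdxB8Sub θ` they range over print's family.  The R433 species of the full-family pin is
kept and SAID: the sub-family leaf is WEAKER than the full-family leaf (`b8LeafOfRecordSub_of_b8LeafOfRecord` = g31's `b8LeafOfRecord_subtype`, never conversely), so every
node reading `b8` as an in-edge is STRONGER at a sub-family record by exactly that difference.

WHAT IS DEFINED ∕ PROVED (§1, Stage-3 keyed like `CarriersB8` §1; 0 sorry): `IdxB8Laws L i` (the three laws as ONE `Prop` structure on `ZdIdx`, in the literal shapes n05-a's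
theorems display: `scale`, `trunc_lt`∕`trunc_top` per `m < k` as in `restr129_succ_of_truncation`, `cover` = `h16` as in `thm2_of135_zd3_univ`); `IdxB8Sub θ`; the bundle
substitution `PrintedCarriersR.withB8OfRecordSub X θ lam` (the [B8] group of record RE-KEYED over the sub-index; SAME residual layer `ResidB8 θ` — Prop. 7's axial map is read on
the sub-family only, `lam.toAxial ∘ Subtype.val`); `B8LeafOfRecordSub θ lam`; `b8LeafRS_withB8OfRecordSub_iff : Iff.rfl`; **`b8LeafOfRecordSub_of_b8LeafOfRecord`** (OLD ⇒ NEW,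
g31's `b8LeafOfRecord_subtype` BY NAME); the carrier law (1.36) ⊂ (1.62) on the sub-family (`C136_C162_famB8OfRecordSub`); `rfl` faces (`withB8OfRecordSub_runs10 ∕ _F12 ∕ _c12`,
`withRuns10_withB8OfRecordSub`, `withB12_withB8OfRecordSub`, `carriers₃_withB8OfRecordSub`); **`idxB8Laws_of_member_univ` ∕ `nonempty_idxB8Sub`** — n05-a's non-vacuity
members (`B8LeafModelZd3NonVacuity.exists_member_univ`: `Ω_j = ℤᵈ`, `Λs m j = ℤᵈ` iff `j = m`) AT SPACING `η = L⁻ᵏ` satisfy all three laws at EVERY depth `k ≥ 1` (№8 by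
`B8Thm4TruncationLocal.mem_blockSites_of_under_one` + `B8Eq131Cubes.under_flm`, №11 by `under_flm`), so the sub-index is inhabited by GENUINE members and the leaf's
member-wise conjuncts are not vacuous.  The pin on Stage-11 parameters, the views and the record predicate `IsRecordOfRecord₁₁CB10YZWB8subB12` are the sequel
`Node00/Record11CarriersB8Sub`.  HONEST FRAMING: definitions + kernel bookkeeping; NO estimate; nothing of [Balaban1985RegularSpaces] asserted; N05 NOT discharged; counts
unmoved (5∕28); one finite T⁴ programme at fixed ε — NOT continuum ∕ ℝ⁴ ∕ infinite volume ∕ OS ∕ mass gap ∕ Clay.  No `sorry`, no `axiom`, no `opaque`, no `instance`, no `notation`. -/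

noncomputable section

namespace Literature.MathematicalPhysics.QuantumFieldTheory.Balaban1983to89.Node00

open T4Continuum AveragingRT T4FiniteEpsInhabited FlowStep FlowStepRuns DagBinding T4DatumAssembly
open B8LeafKnitRS (B8LeafRS)
open B8LeafModelZd (ZdIdx)
open B8Lemma1NonAbelian (blockPairNA)
open B7Prop1Explicit B7Prop1Local B8Ineq130
open B8Ineq132 (Under)
open B8Eq131Cubes (flm under_flm)
open Literature.MathematicalPhysics.QuantumLattice (blockSites)
open scoped Matrix.Norms.L2Operator

/-! ## §1. The three index laws, the sub-index, the re-keyed [B8] group of record, the sub-family leaf, OLD ⇒ NEW, inhabitation -/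

section SubIndex

variable {D : ℕ} (L : ℕ)

/-- **THE THREE LOCATED INDEX LAWS print has by construction** (n05-a g5∕g6 design points №7, №8, №11), on n05-a's geometric datum `ZdIdx`: (`scale`) `Lᵏ·η ≤ 1` — print's
`η = L⁻ᵏ` (p. 77); (`trunc_lt`, `trunc_top`) for every `m < k` the level-`m` constraint family is the TRUNCATION of the level-`(m+1)` one: equal below `m`, and at `m` the union
of the kept tops with the blocks of the next tops ((1.19), (1.34); the hypothesis pair of `B8Prop5SocketDatum.restr129_succ_of_truncation` ∕ `B8Thm4TruncationLocal.inAx_truncate`);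
(`cover`) (1.6) AT EVERY LEVEL `ℓ ≤ k`: every level-`ℓ` block inside `Ω_ℓ` lies under some tower top of the partition (the hypothesis `h16` of
`B8Ineq165AllLevels.norm_avg_sub_le_allLevels_of135`, displayed verbatim in n05-a's `thm2_of135_zd3_univ`; NECESSARY by `B8Ineq165AllLevelsIndexLaw`).
[cite: Balaban1985RegularSpaces, p.77 («T_η, η = L^{−k}»; (1.3)–(1.6)), (1.19) p.79, (1.34) p.82] -/
structure IdxB8Laws (i : ZdIdx D L) : Prop where
  /-- №7: `Lᵏη ≤ 1` -/
  scale : (L : ℝ) ^ i.k * i.η ≤ 1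
  /-- №8, below the top: `Λs m j = Λs (m+1) j` for `j < m < k` -/
  trunc_lt : ∀ m, m < i.k → ∀ j, j < m → i.Λs m j = i.Λs (m + 1) j
  /-- №8, at the top: `Λs m m = Λs (m+1) m ∪ ⋃_{y ∈ Λs (m+1) (m+1)} B(y)` for `m < k` -/
  trunc_top : ∀ m, m < i.k → ∀ x, x ∈ i.Λs m m ↔ x ∈ i.Λs (m + 1) m ∨ ∃ y ∈ i.Λs (m + 1) (m + 1), x ∈ blockSites L y
  /-- №11: (1.6) at every level `ℓ ≤ k` (`h16`) -/
  cover : ∀ ℓ, ℓ ≤ i.k → ∀ w : B7Prop1Explicit.Site D, (∀ x, InBox (tlo L w ℓ) (thi L w ℓ) x → x ∈ i.Ω ℓ) →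
    ∃ j, ℓ ≤ j ∧ j ≤ i.k ∧ ∃ y ∈ i.Λs i.k j, Under L (j - ℓ) y w

variable {L}

/-- **n05-a's non-vacuity members satisfy the three laws AT SPACING `η = L⁻ᵏ`** (`Ω_j = ℤᵈ` for all `j`, `Λs m j = ℤᵈ` iff `j = m`, else `∅`): №7 with equality; №8 because
below the top both families are empty and at the top every site lies in the block of its floor (`mem_blockSites_of_under_one` + `under_flm`); №11 with `j := k`, the tower top
`:= flm L (k − ℓ) w` (`under_flm`). [cite: Balaban1985RegularSpaces, p.77 («we admit Ω_j = T_η»), (1.6) p.77 (bookkeeping: genuine members of the sub-index)] -/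
theorem idxB8Laws_of_member_univ (hL : 1 ≤ L) {i : ZdIdx D L} (hη : i.η = ((L : ℝ)⁻¹) ^ i.k)
    (hΛ : ∀ m j, i.Λs m j = {_y | j = m}) : IdxB8Laws L i where
  scale := by
    rw [hη, ← mul_pow, mul_inv_cancel₀ (by exact_mod_cast (show L ≠ 0 by omega)), one_pow]
  trunc_lt m _ j hj := by
    rw [hΛ, hΛ]
    ext
    simp only [Set.mem_setOf_eq]
    omega
  trunc_top m _ x := by
    simp only [hΛ, Set.mem_setOf_eq, true_iff]
    exact Or.inr ⟨flm L 1 x, trivial, B8Thm4TruncationLocal.mem_blockSites_of_under_one (under_flm hL 1 x)⟩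
  cover ℓ hℓ w _ := ⟨i.k, hℓ, le_rfl, flm L (i.k - ℓ) w, by rw [hΛ]; rfl, under_flm hL (i.k - ℓ) w⟩

variable (θ : Stage3Params)

/-- **THE SUB-INDEX OF RECORD**: the admitted members (`Ω₀ = T_η`) obeying the three laws. [cite: Balaban1985RegularSpaces, p.77, (1.6) p.77, (1.19) p.79, (1.34) p.82] -/
abbrev IdxB8Sub : Type := {i : IdxB8 θ // IdxB8Laws θ.L i.1}

/-- **The sub-index is inhabited by GENUINE members at every depth `k ≥ 1`** (n05-a's `exists_member_univ` at `η = L⁻ᵏ`). [cite: Balaban1985RegularSpaces, p.77 (bookkeeping: the index of record is inhabited)] -/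
theorem nonempty_idxB8Sub_depth {k : ℕ} (hk : 1 ≤ k) : ∃ i : IdxB8Sub θ, i.1.1.k = k := by
  have hL : 1 ≤ θ.L := le_trans (by norm_num) θ.two_le_L
  have hη : (0 : ℝ) < ((θ.L : ℝ)⁻¹) ^ k := pow_pos (inv_pos.mpr (by exact_mod_cast (show 0 < θ.L by omega))) k
  obtain ⟨i, h0, hik, hiη, -, hΛ, -⟩ := B8LeafModelZd3NonVacuity.exists_member_univ (d := θ.D) hL hk hη
  exact ⟨⟨⟨i, h0⟩, idxB8Laws_of_member_univ hL (by rw [hiη, hik]) hΛ⟩, hik⟩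

/-- The sub-index is non-empty. [cite: Balaban1985RegularSpaces, p.77 (bookkeeping)] -/
theorem nonempty_idxB8Sub : Nonempty (IdxB8Sub θ) :=
  let ⟨i, _⟩ := nonempty_idxB8Sub_depth θ le_rfl
  ⟨i⟩

variable {θ}

/-- **THE GAUGE-FIXING FAMILY OF RECORD OVER THE SUB-INDEX** (g31's `famB8OfRecord` restricted). [cite: Balaban1985RegularSpaces, (1.29) p.81, (1.33)–(1.40) pp.82–83, (1.62) p.87, (1.66) p.88, (1.140) p.100, (1.146) p.101] -/
abbrev famB8OfRecordSub (θ : Stage3Params) (β : ℝ) (len : B7Prop1Explicit.Site θ.D → ℝ) (i : IdxB8Sub θ) : B8SectGH.GFData3 :=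
  famB8OfRecord θ β len i.1

/-- **THE [B8] GROUP OF RECORD RE-KEYED OVER THE SUB-INDEX, substituted into a carrier bundle**: g31's `withB8OfRecord` with `I8b := IdxB8Sub θ`, the family, its R-extension
and Proposition 7's axial map read through `Subtype.val` (SAME residual layer `lam : ResidB8 θ`); every other group of `X` unchanged.
[cite: Balaban1985RegularSpaces, Lemma 1 p.79 – Thm 8 p.101 (the carriers of the typed statements)] -/
def _root_.Literature.MathematicalPhysics.QuantumFieldTheory.Balaban1983to89.DagBinding.PrintedCarriersR.withB8OfRecordSub (X : PrintedCarriersR)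
    (θ : Stage3Params) (lam : ResidB8 θ) : PrintedCarriersR :=
  { X with
    I8a := B7Prop1Explicit.Site θ.D × Fin θ.D, I8b := IdxB8Sub θ, I8c := lam.I8c, I8d := lam.I8d, d8 := θ.D, L8 := θ.L,
    C₂ := lam.C₂, B₁' := lam.B₁', B₀' := lam.inp.B₀', B₁ := lam.B₁, B₂ := lam.B₂, c₁ := lam.c₁, inp8 := lam.inp, B₀β := lam.B₀β,
    loc8 := blockPairNA θ.D θ.L θ.𝔸, fam8 := fun i => (famB8OfRecord θ lam.β lam.len i.1).toGFData2, lan8 := lam.lan, cub8 := lam.cub,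
    toAxial8 := fun i => lam.toAxial i.1,
    C140 := fun i => (famB8OfRecord θ lam.β lam.len i.1).C140, InR := fun i => (famB8OfRecord θ lam.β lam.len i.1).InR,
    proj140 := fun i α₂ U₀ U₁ h => proj140_famB8OfRecord lam.β lam.len i.1 α₂ U₀ U₁ h }

/-- **THE `b8` LEAF AT THE RE-KEYED GROUP OF RECORD, IN ITS SURVIVING FORM, OVER THE SUB-FAMILY** (Lemma 1 p. 79, Thm 2 p. 83, Prop. 3 p. 87, Thm 4 p. 88, Prop. 5 p. 94,
Prop. 6 p. 99, Prop. 7 p. 100 faithful, Thm 8 p. 101 surviving at γ = 1) — the conclusion of g31's `b8LeafOfRecord_subtype` at the predicate `IdxB8Laws`.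
[cite: Balaban1985RegularSpaces, Lemma 1 p.79, Thm 2 p.83, Prop. 3 p.87, Thm 4 p.88, Prop. 5 p.94, Prop. 6 p.99, Prop. 7 p.100, Thm 8 p.101 (surviving form, GAPS G-B8-13)] -/
def B8LeafOfRecordSub (θ : Stage3Params) (lam : ResidB8 θ) : Prop :=
  B8LeafRS θ.D (θ.L : ℝ) lam.C₂ lam.B₁' lam.inp.B₀' lam.B₁ lam.B₂ lam.c₁ lam.inp lam.B₀β (blockPairNA θ.D θ.L θ.𝔸)
    (fun j : IdxB8Sub θ => famB8OfRecord θ lam.β lam.len j.1) lam.lan lam.cub (fun j => lam.toAxial j.1)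

/-- The surviving leaf over the SUBSTITUTED bundle's own [B8] group IS `B8LeafOfRecordSub θ lam` (`Iff.rfl`). [cite: Balaban1985RegularSpaces, Lemma 1 – Thm 8 pp.79–101 (bookkeeping)] -/
theorem b8LeafRS_withB8OfRecordSub_iff (X : PrintedCarriersR) (θ : Stage3Params) (lam : ResidB8 θ) :
    B8LeafRS (X.withB8OfRecordSub θ lam).d8 (X.withB8OfRecordSub θ lam).L8 (X.withB8OfRecordSub θ lam).C₂ (X.withB8OfRecordSub θ lam).B₁'
        (X.withB8OfRecordSub θ lam).B₀' (X.withB8OfRecordSub θ lam).B₁ (X.withB8OfRecordSub θ lam).B₂ (X.withB8OfRecordSub θ lam).c₁ (X.withB8OfRecordSub θ lam).inp8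
        (X.withB8OfRecordSub θ lam).B₀β (X.withB8OfRecordSub θ lam).loc8 (X.withB8OfRecordSub θ lam).fam8R (X.withB8OfRecordSub θ lam).lan8
        (X.withB8OfRecordSub θ lam).cub8 (X.withB8OfRecordSub θ lam).toAxial8 ↔
      B8LeafOfRecordSub θ lam :=
  Iff.rfl

/-- **OLD ⇒ NEW: the full-family leaf of record gives the sub-family leaf** — g31's `b8LeafOfRecord_subtype` BY NAME (conjunct by conjunct through n05-a's `…_precomp` lemmas);
never conversely. [cite: Balaban1985RegularSpaces, Lemma 1 – Thm 8 pp.79–101 (bookkeeping: restriction of the family index)] -/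
theorem b8LeafOfRecordSub_of_b8LeafOfRecord (lam : ResidB8 θ) (h : B8LeafOfRecord θ lam) : B8LeafOfRecordSub θ lam :=
  b8LeafOfRecord_subtype (fun i : IdxB8 θ => IdxB8Laws θ.L i.1) lam h

/-- **THE CARRIER LAW (1.36) ⊂ (1.62) HOLDS ON THE SUB-FAMILY** (g31's `C136_C162_famB8OfRecord` at `i.1`; the law under which the typed leaf implies the surviving one).
[cite: Balaban1985RegularSpaces, (1.36) p.82, (1.62) p.87] -/
theorem C136_C162_famB8OfRecordSub (β : ℝ) (len : B7Prop1Explicit.Site θ.D → ℝ) (i : IdxB8Sub θ) (b b₂ s : ℝ) (U₀ : (famB8OfRecord θ β len i.1).Cfg)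
    (U₁ : (famB8OfRecord θ β len i.1).Pert) (h : (famB8OfRecord θ β len i.1).C136 b b₂ s U₀ U₁) : (famB8OfRecord θ β len i.1).C162 b s U₀ U₁ :=
  C136_C162_famB8OfRecord β len i.1 b b₂ s U₀ U₁ h

/-- The substitution does not touch the [B10] group (`rfl`) … [cite: Balaban1985UV3, (1)–(5) p.256 (bookkeeping)] -/
theorem withB8OfRecordSub_runs10 (X : PrintedCarriersR) (θ : Stage3Params) (lam : ResidB8 θ) : (X.withB8OfRecordSub θ lam).runs10 = X.runs10 := rfl

/-- … nor the [B12 §§2–5] group (`rfl` ×2) … [cite: Balaban1987RG1, Lemma 4 p.280 (bookkeeping)] -/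
theorem withB8OfRecordSub_F12_c12 (X : PrintedCarriersR) (θ : Stage3Params) (lam : ResidB8 θ) :
    (X.withB8OfRecordSub θ lam).F12 = X.F12 ∧ (X.withB8OfRecordSub θ lam).c12 = X.c12 := ⟨rfl, rfl⟩

/-- … commutes with the [B10] re-binding `withRuns10` (`rfl`) … [cite: Balaban1985UV3, (1)–(5) p.256 (bookkeeping)] -/
theorem withRuns10_withB8OfRecordSub (X : PrintedCarriersR) {J : Type} (r : J → B10.RunData) (θ : Stage3Params) (lam : ResidB8 θ) :
    (X.withRuns10 r).withB8OfRecordSub θ lam = (X.withB8OfRecordSub θ lam).withRuns10 r := rfl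

/-- … with the [B12] substitution `withB12` (`rfl`) … [cite: Balaban1987RG1, Lemma 4 p.280 (bookkeeping)] -/
theorem withB12_withB8OfRecordSub (X : PrintedCarriersR) (F12 : B12Sec2to5.Lemma4Frame) (c12 : B12Sec2to5.Lemma4Consts) (θ : Stage3Params) (lam : ResidB8 θ) :
    (X.withB12 F12 c12).withB8OfRecordSub θ lam = (X.withB8OfRecordSub θ lam).withB12 F12 c12 := rfl

/-- … and passes through the Stage-3 substitutions `carriers₃` (`rfl`). [cite: Balaban1984PropagatorsII, pp.223–250 (bookkeeping)] -/
theorem carriers₃_withB8OfRecordSub (θ₃ : Stage3Params) (X : PrintedCarriersR) (θ : Stage3Params) (lam : ResidB8 θ) :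
    carriers₃ θ₃ (X.withB8OfRecordSub θ lam) = (carriers₃ θ₃ X).withB8OfRecordSub θ lam := rfl

end SubIndex

/-! ## §1b (v1.1). THE TOWER LAW AT EVERY TRUNCATION IS A THEOREM OF THE SUB-INDEX (dag-n05-d LOCATED-1 l.≈12826, law (L1) of the letters-fed knit: «∀ m ≤ k, ∀ j ≤ m,
∀ y ∈ Λs m j, Bʲ(y) ⊂ Ω_j» — `ZdIdx.htower` is the level-`k` instance; №8 + `hΩ` + the block-tower geometry give all truncations) -/

section TowerAll

variable {D L : ℕ}

/-- Bookkeeping: n05-a's box form of the level-`m` tower over `y` IS `Under L m y` (`B8Eq106Local.under_iff_tower`). [cite: Balaban1985RegularSpaces, (1.6) p.77 (bookkeeping)] -/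
private theorem inBox_tower_iff_under (L m : ℕ) (y z : B7Prop1Explicit.Site D) : InBox (tlo L y m) (thi L y m) z ↔ Under L m y z := by
  rw [B8Eq106Local.under_iff_tower]
  exact ⟨fun h => ⟨fun i => (h i).1, fun i => (h i).2⟩, fun h i => ⟨h.1 i, h.2 i⟩⟩

/-- **THE TOWER LAW AT EVERY TRUNCATION LEVEL** (dag-n05-d's (L1), the second law the Prop-5 JOIN reads besides №8): on the sub-index, for every `m ≤ k`, `j ≤ m` and `y ∈ Λs m j`,
the level-`j` tower `Bʲ(y)` lies in `Ω_j` — by downward induction from `ZdIdx.htower` (level `k`) through the truncation law №8 (`trunc_lt`: below `m` the families agree;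
`trunc_top`: a new top `y ∈ B(y′)`, `y′ ∈ Λs (m+1) (m+1)`, has `Bᵐ(y) ⊂ B^{m+1}(y′) ⊂ Ω_{m+1} ⊂ Ω_m` by `B8Eq131Derivation.under_succ_of_under_block` and `ZdIdx.hΩ`).  So the
letters-fed knit's index `{i ∕∕ i.Ω 0 = univ ∧ (L1) ∧ (L2)}` IS `IdxB8Sub` (with №7, №11 on top). [cite: Balaban1985RegularSpaces, (1.5)–(1.6) p.77, (1.19) p.79, (1.34) p.82, p.89] -/
theorem IdxB8Laws.tower_all {i : ZdIdx D L} (h : IdxB8Laws L i) :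
    ∀ m, m ≤ i.k → ∀ j, j ≤ m → ∀ y ∈ i.Λs m j, ∀ x, InBox (tlo L y j) (thi L y j) x → x ∈ i.Ω j := by
  suffices H : ∀ n m, m + n = i.k → ∀ j, j ≤ m → ∀ y ∈ i.Λs m j, ∀ x, InBox (tlo L y j) (thi L y j) x → x ∈ i.Ω j by
    intro m hm
    exact H (i.k - m) m (by omega)
  intro n
  induction n with
  | zero =>
    intro m hm j hj y hy x hx
    rw [Nat.add_zero] at hm
    subst hm
    exact i.htower j hj y hy x hx
  | succ n ih =>
    intro m hm j hj y hy x hx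
    have hmk : m < i.k := by omega
    have ih' := ih (m + 1) (by omega)
    rcases Nat.lt_or_ge j m with hjm | hjm
    · rw [h.trunc_lt m hmk j hjm] at hy
      exact ih' j (by omega) y hy x hx
    · obtain rfl : j = m := le_antisymm hj hjm
      rcases (h.trunc_top j hmk y).1 hy with hy' | ⟨y', hy', hyy'⟩
      · exact ih' j (Nat.le_succ j) y hy' x hx
      · have h1 : Under L 1 y' y := B8Thm4TruncationLocal.under_one_of_mem_blockSites hyy'
        have hx' : Under L (j + 1) y' x := B8Eq131Derivation.under_succ_of_under_block h1 ((inBox_tower_iff_under L j y x).1 hx)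
        exact i.hΩ j (ih' (j + 1) le_rfl y' hy' x ((inBox_tower_iff_under L (j + 1) y' x).2 hx'))

/-- The same at a member of the sub-index of record. [cite: Balaban1985RegularSpaces, (1.5)–(1.6) p.77 (bookkeeping)] -/
theorem IdxB8Sub.tower_all {θ : Stage3Params} (i : IdxB8Sub θ) :
    ∀ m, m ≤ i.1.1.k → ∀ j, j ≤ m → ∀ y ∈ i.1.1.Λs m j, ∀ x, InBox (tlo θ.L y j) (thi θ.L y j) x → x ∈ i.1.1.Ω j :=
  i.2.tower_all

end TowerAll

end Literature.MathematicalPhysics.QuantumFieldTheory.Balaban1983to89.Node00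

end
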